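import Summits.ABC.IUTFork.Repair.RHReachLedgerQ2GenuineTies
import Summits.ABC.IUTFork.Repair.RHReachLedgerQ2GenuineRationalJ
import HarnessLib

/-!
# R-H ROUND 2 Q2(27) — ties included, RATIONAL-`j` bed: `K2Target27 ⟸ (j(λ) ∈ ℚ ∧ (O) at the bad places)|Σ₂₇`, and the R14 recut of the
# tie-covering certificate-free roads `HStar27OnSigma27 ∧ STRUCT|Σ₂₇ ∧ NUM(deep ∧ bad) ∧ CONE-bad ⟹ ABC`

PROOF-ONLY file (0 definitions, 0 `Prop` facts, no instance, no notation; abc-iut cell, D-0079 RESCUE sub-cell R-H, rung LADDER-ABC:A2.RESCUE.H;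
pair n = 10 typer abc-iut-rh-typ-10 (R14 recut lane for row 27); sequel BY NAME to abc-iut-rh2-L1's `Repair/RHReachLedgerQ2GenuineTies.lean`
(`k2Target27_of_outer` / `k2Target27_of_isGalois_outer`: the certificate binder discharged ON THE TIES TOO, residual = a bad prime `p` with
`e_p = p^a(p−1)` carrying a residue-degree-`1` place) and to `Repair/RHReachLedgerQ2GenuineRationalJ.lean` (`isGalois_rat_K_of_jInv_mem_range`:
`j(λ) ∈ ℚ ⟹ K/ℚ` Galois). TAKES NO SIDE on [IUTchIII] Cor. 3.12 / [IUTchIV] Thm. 1.10 or on any author (Mochizuki / Scholze–Stix / Joshi /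
Dupuy–Hilado); typed ≠ proved; instantiated ≠ endorsed; nothing here asserts abc proved or refuted.

* §1 `jInv_mem_range_of_mem_range` — `λ ∈ ℚ ⟹ j(λ) ∈ ℚ` (`Cor22.jInv_map`): the Frey–Hellegouarch bed (`λ` rational) is inside the rational-`j` bed.
* §2 `cor312NonarchOf_of_ledgerAtDatum_outer_of_jInv_mem_range` / `k2Target27_of_jInv_mem_range_outer` — abc-iut-rh2-L1's
  `cor312NonarchOf_of_ledgerAtDatum_outer_of_isGalois` / `k2Target27_of_isGalois_outer` with the Galois hypothesis DISCHARGED by `j(λ) ∈ ℚ`: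
  `K2Target27` from «every Σ₂₇ datum has `j(λ) ∈ ℚ` and, at each bad place `w ∣ p`, `e(𝔭_w∣p) ≠ p^a(p−1)` for all `a` OR `f(𝔭_w∣p) ≥ 2`» —
  explicit 1, NO witness data, NO Galois hypothesis: a condition on the POINT and the two ramification columns `(e_w, f_w)` only;
  `k2Target27_of_x_mem_range_outer` — the same on the RATIONAL-`λ` presentation (`λ ∈ ℚ`, via §1).
* §3 the R14 RECUT of the tie-covering roads (abc-iut-rh2-L1 defers recuts to this lane): `abc_of_hStar27OnSigma27_of_isGalois_outer_hregBad`
  (abc-iut-rh2-L1's `hGO` VERBATIM) and `abc_of_hStar27OnSigma27_of_jInv_mem_range_outer_hregBad`, both over p480035's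
  `abc_of_k2Target27_of_hStar27OnSigma27_hregBad` (cone binder cut to the SZPIRO-BAD locus, abc-iut-s2-p2's `hregBad` VERBATIM — NOT the blanket
  `hreg`, which `Conditional.not_hreg_v4` refutes). Explicit 4 = H⋆₂₇(Σ₂₇) · STRUCT(Σ₂₇) · NUM(deep ∧ bad) · CONE(Szpiro-bad).
HONEST SCOPE. ROW 27's RESIDUAL OF RECORD after this file and its parents (kernel-exact): `K2Target27` stays OPEN as typed exactly at Σ₂₇ data
with (a) a bad prime `p`, `e_p = p^a(p−1)` (forcing `l ∣ p − 1`), carrying a residue-degree-`1` place — ONE (datum, `l`, type) triple on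
abc-iut-rh2-q3-num's 258-datum universe (Q3-TIE27-v1 30af8025d2a3c782: λ₇ at `l = 41`, `p = 1231`, if `e_v = 30`), or (b) `j(λ) ∉ ℚ` and `K/ℚ` not
Galois with a non-uniform bad fibre; plus H⋆₂₇ itself (`HStar27OnSigma27`, a HYPOTHESIS SHAPE over OUR typed objects — Dupuy–Hilado (Ind2) = all
`ℤ_p`-lattice automorphisms, STRONGER-THAN-PRINT; which genuine data satisfy it is abc-iut-rh-num-1's table, k1 74.8 % pooled / 98.9 % on frey
Szpiro-bad ∧ window), NUM(deep ∧ bad) and CONE-bad (`hregBad`, an assumption label, neither proved nor refuted as typed).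
[cite: Mochizuki2012, IUTchI Def. 3.1 (b) p. 61, Rmk. 3.1.5 p. 65; IUTchIII Cor. 3.12 p. 173–174; IUTchIV Thm. 1.10 p. 22, Cor. 2.2 (ii) p. 46]
[cite: NeukirchANT1999, Ch. I §9 (9.1), Ch. II (5.5)–(5.7)] [cite: DupuyHilado2025, §1 (1.1), §3.9] [claim: Mochizuki2012, status: disputed] for every
IUT sentence quoted. Axioms: standard.
-/

noncomputable section

open Set Function NumberField IsDedekindDomain

namespace Summit.ABC.IUTFork.Repair.RH.ReachLedgerQ2

open Thm311 Thm311.Real Cor312 Cor312Vol Cor312Prov Literature.IUT.LogThetaLattice Literature.IUT.LogVolume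
  Literature.IUT.HodgeTheaters Literature.IUT.LogVolume.ThetaData Summit.ABC.IUTFork.Repair.RH.ReachLedger
open Literature.NumberTheory.DiophantineGeometry Literature.NumberTheory.DiophantineGeometry.GenEll Summit.ABC.ABC.Theorems
  Summit.ABC.IUTFork.Conditional
open scoped Classical

/-! ## §1. `λ ∈ ℚ ⟹ j(λ) ∈ ℚ` -/

/-- **`λ ∈ ℚ ⟹ j(λ) ∈ ℚ`**: the Legendre `j`-invariant `j(λ) = 2⁸(λ²−λ+1)³/(λ²(λ−1)²)` (`Cor22.jInv`) commutes with ring maps (`Cor22.jInv_map`),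
so a point presented over a `ℚ`-rational `λ` (the Frey–Hellegouarch bed) lies in the rational-`j` bed of `isGalois_rat_K_of_jInv_mem_range`.
[cite: MochizukiGenEll2010, §1 p.4] -/
theorem jInv_mem_range_of_mem_range {F : Type*} [Field F] [CharZero F] {x : F} (hx : x ∈ Set.range (algebraMap ℚ F)) :
    Cor22.jInv x ∈ Set.range (algebraMap ℚ F) := by
  obtain ⟨q, rfl⟩ := hx
  exact ⟨Cor22.jInv q, Cor22.jInv_map (algebraMap ℚ F) q⟩

/-! ## §2. Ties included, rational-`j` bed -/

section KFamily

variable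
    (M : ∀ (P : NFPoint) (l : ℕ) (T : Cor22.ThetaVolumeDatumAt P l), Type) [∀ P l T, Field (M P l T)] [∀ P l T, NumberField (M P l T)]
    (archPk : ∀ (P : NFPoint) (l : ℕ) (T : Cor22.ThetaVolumeDatumAt P l), letI := T.instFieldF; letI := T.instNumberFieldF; letI := T.instAlgebraF; letI := T.instFieldK;
        letI := T.instNumberFieldK; letI := T.instAlgebraK; letI := T.instFieldFbar; letI := T.instAlgebraFbar;
        letI := T.instAlgebraKFbar; letI := T.instIsElliptic;
      ∀ (j : (thetaIndex (pilotDataOfK T.D T.K)).Label) (vQ : (thetaIndex (pilotDataOfK T.D T.K)).VQ), Set ((logShellsDH (pilotDataOfK T.D T.K) (analyticLogv T.K)).Packet j vQ))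
    (archSub : ∀ (P : NFPoint) (l : ℕ) (T : Cor22.ThetaVolumeDatumAt P l), letI := T.instFieldF; letI := T.instNumberFieldF; letI := T.instAlgebraF; letI := T.instFieldK;
        letI := T.instNumberFieldK; letI := T.instAlgebraK; letI := T.instFieldFbar; letI := T.instAlgebraFbar;
        letI := T.instAlgebraKFbar; letI := T.instIsElliptic;
      ∀ (j : (thetaIndex (pilotDataOfK T.D T.K)).Label) (v : (thetaIndex (pilotDataOfK T.D T.K)).V), Set ((logShellsDH (pilotDataOfK T.D T.K) (analyticLogv T.K)).Packet j ((thetaIndex (pilotDataOfK T.D T.K)).over v)))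
    (Ψ : ∀ (P : NFPoint) (l : ℕ) (T : Cor22.ThetaVolumeDatumAt P l), letI := T.instFieldF; letI := T.instNumberFieldF; letI := T.instAlgebraF; letI := T.instFieldK;
        letI := T.instNumberFieldK; letI := T.instAlgebraK; letI := T.instFieldFbar; letI := T.instAlgebraFbar;
        letI := T.instAlgebraKFbar; letI := T.instIsElliptic;
      ℤ → ∀ v : (thetaIndex (pilotDataOfK T.D T.K)).V, v ∈ (thetaIndex (pilotDataOfK T.D T.K)).Vbad → Set ((logShellsDH (pilotDataOfK T.D T.K) (analyticLogv T.K)).StarPacket v))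
    (act : ∀ (P : NFPoint) (l : ℕ) (T : Cor22.ThetaVolumeDatumAt P l), letI := T.instFieldF; letI := T.instNumberFieldF; letI := T.instAlgebraF; letI := T.instFieldK;
        letI := T.instNumberFieldK; letI := T.instAlgebraK; letI := T.instFieldFbar; letI := T.instAlgebraFbar;
        letI := T.instAlgebraKFbar; letI := T.instIsElliptic;
      ℤ → ∀ v : (thetaIndex (pilotDataOfK T.D T.K)).V, v ∈ (thetaIndex (pilotDataOfK T.D T.K)).Vbad → (logShellsDH (pilotDataOfK T.D T.K) (analyticLogv T.K)).StarPacket v → Module.End ℚ ((logShellsDH (pilotDataOfK T.D T.K) (analyticLogv T.K)).StarPacket v))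
    (Mmod : ∀ (P : NFPoint) (l : ℕ) (T : Cor22.ThetaVolumeDatumAt P l), letI := T.instFieldF; letI := T.instNumberFieldF; letI := T.instAlgebraF; letI := T.instFieldK;
        letI := T.instNumberFieldK; letI := T.instAlgebraK; letI := T.instFieldFbar; letI := T.instAlgebraFbar;
        letI := T.instAlgebraKFbar; letI := T.instIsElliptic;
      ℤ → ∀ j : (thetaIndex (pilotDataOfK T.D T.K)).LabelStar, Set ((logShellsDH (pilotDataOfK T.D T.K) (analyticLogv T.K)).GlobalPacket j.1))
    (region : ∀ (P : NFPoint) (l : ℕ) (T : Cor22.ThetaVolumeDatumAt P l), letI := T.instFieldF; letI := T.instNumberFieldF; letI := T.instAlgebraF; letI := T.instFieldK;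
        letI := T.instNumberFieldK; letI := T.instAlgebraK; letI := T.instFieldFbar; letI := T.instAlgebraFbar;
        letI := T.instAlgebraKFbar; letI := T.instIsElliptic;
      ℤ → ∀ j : (thetaIndex (pilotDataOfK T.D T.K)).LabelStar, FinDivisor (M P l T) → ∀ vQ : (thetaIndex (pilotDataOfK T.D T.K)).VQ, Set ((logShellsDH (pilotDataOfK T.D T.K) (analyticLogv T.K)).Packet j.1 vQ))
    (n : ∀ (P : NFPoint) (l : ℕ) (T : Cor22.ThetaVolumeDatumAt P l), ℤ)
    {HT : ∀ (P : NFPoint) (l : ℕ) (T : Cor22.ThetaVolumeDatumAt P l), Type} {LogLink : ∀ (P : NFPoint) (l : ℕ) (T : Cor22.ThetaVolumeDatumAt P l), HT P l T → HT P l T → Type}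
    {IsFull : ∀ (P : NFPoint) (l : ℕ) (T : Cor22.ThetaVolumeDatumAt P l), ∀ {s t : HT P l T}, LogLink P l T s t → Prop}
    (lat : ∀ (P : NFPoint) (l : ℕ) (T : Cor22.ThetaVolumeDatumAt P l), LGPGaussianLogThetaLattice (LogLink P l T) (IsFull P l T))
    {Frd : ∀ (P : NFPoint) (l : ℕ) (T : Cor22.ThetaVolumeDatumAt P l), Type} {IsoF : ∀ (P : NFPoint) (l : ℕ) (T : Cor22.ThetaVolumeDatumAt P l), Frd P l T → Frd P l T → Type} {Ob : ∀ (P : NFPoint) (l : ℕ) (T : Cor22.ThetaVolumeDatumAt P l), Frd P l T → Type}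
    {realify : ∀ (P : NFPoint) (l : ℕ) (T : Cor22.ThetaVolumeDatumAt P l), Frd P l T → Frd P l T} {Strip : ∀ (P : NFPoint) (l : ℕ) (T : Cor22.ThetaVolumeDatumAt P l), Type} {IsoS : ∀ (P : NFPoint) (l : ℕ) (T : Cor22.ThetaVolumeDatumAt P l), Strip P l T → Strip P l T → Type}
    {Mv : ∀ (P : NFPoint) (l : ℕ) (T : Cor22.ThetaVolumeDatumAt P l), letI := T.instFieldF; letI := T.instNumberFieldF; letI := T.instAlgebraF; letI := T.instFieldK;
        letI := T.instNumberFieldK; letI := T.instAlgebraK; letI := T.instFieldFbar; letI := T.instAlgebraFbar;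
        letI := T.instAlgebraKFbar; letI := T.instIsElliptic;
      ∀ v : (thetaIndex (pilotDataOfK T.D T.K)).V, v ∈ (thetaIndex (pilotDataOfK T.D T.K)).Vbad → Type}
    [∀ P l T v h, Monoid (Mv P l T v h)]
    (sig : ∀ (P : NFPoint) (l : ℕ) (T : Cor22.ThetaVolumeDatumAt P l), letI := T.instFieldF; letI := T.instNumberFieldF; letI := T.instAlgebraF; letI := T.instFieldK;
        letI := T.instNumberFieldK; letI := T.instAlgebraK; letI := T.instFieldFbar; letI := T.instAlgebraFbar;
        letI := T.instAlgebraKFbar; letI := T.instIsElliptic;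
      GlobalLGPFrobenioidSignature (thetaIndex (pilotDataOfK T.D T.K)).lstar (thetaIndex (pilotDataOfK T.D T.K)).V (· ∈ (thetaIndex (pilotDataOfK T.D T.K)).Vbad) (Frd P l T) (IsoF P l T) (Ob P l T) (realify P l T)
        (Strip P l T) (IsoS P l T) (Mv P l T))
    (split : ∀ (P : NFPoint) (l : ℕ) (T : Cor22.ThetaVolumeDatumAt P l), SplittingMonoids (Mv P l T))
    {ObΔ : ∀ (P : NFPoint) (l : ℕ) (T : Cor22.ThetaVolumeDatumAt P l), Type} {N : ∀ (P : NFPoint) (l : ℕ) (T : Cor22.ThetaVolumeDatumAt P l), letI := T.instFieldF; letI := T.instNumberFieldF; letI := T.instAlgebraF; letI := T.instFieldK;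
        letI := T.instNumberFieldK; letI := T.instAlgebraK; letI := T.instFieldFbar; letI := T.instAlgebraFbar;
        letI := T.instAlgebraKFbar; letI := T.instIsElliptic;
      ∀ v : (thetaIndex (pilotDataOfK T.D T.K)).V, v ∈ (thetaIndex (pilotDataOfK T.D T.K)).Vbad → Type}
    [∀ P l T v h, Monoid (N P l T v h)] (qData : ∀ (P : NFPoint) (l : ℕ) (T : Cor22.ThetaVolumeDatumAt P l), QPilotData (ObΔ P l T) (N P l T))


include M archPk archSub Ψ act Mmod region n lat sig split qData in
/-- **RATIONAL-`j` rows, ties included: `LedgerAtDatum T` ∧ (O at the bad places) ⟹ `T.Cor312NonarchOf`** — abc-iut-rh2-L1's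
`cor312NonarchOf_of_ledgerAtDatum_outer_of_isGalois` with its Galois hypothesis DISCHARGED by `isGalois_rat_K_of_jInv_mem_range` (`j(λ) ∈ ℚ`); (O) at a
bad place `w ∣ p`: `e(𝔭_w∣p) ≠ p^a(p−1)` for all `a`, OR `f(𝔭_w∣p) ≥ 2`. Row 27's ledger is a HYPOTHESIS; no side taken on [IUTchIII] Cor. 3.12.
[cite: Mochizuki2012, IUTchI Rmk. 3.1.5 p. 65; IUTchIII Cor. 3.12 p. 173–174] [cite: NeukirchANT1999, Ch. I §9 (9.1), Ch. II (5.5)–(5.7)]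
[claim: Mochizuki2012, status: disputed] -/
theorem cor312NonarchOf_of_ledgerAtDatum_outer_of_jInv_mem_range {P : NFPoint} {l : ℕ} (T : Cor22.ThetaVolumeDatumAt P l)
    (hj : Cor22.jInv P.x ∈ Set.range (algebraMap ℚ P.F))
    (hO : letI := T.instFieldF; letI := T.instNumberFieldF; letI := T.instAlgebraF; letI := T.instFieldK;
        letI := T.instNumberFieldK; letI := T.instAlgebraK; letI := T.instFieldFbar; letI := T.instAlgebraFbar;
        letI := T.instAlgebraKFbar; letI := T.instIsElliptic;
      ∀ (pp : Nat.Primes) (w : (thetaIndex (pilotDataOfK T.D T.K)).Fibre (.inr pp)), haveI : Fact (pp : ℕ).Prime := ⟨pp.2⟩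
        placeOf (pilotDataOfK T.D T.K) pp.1 w ∈ (pilotDataOfK T.D T.K).S →
          (∀ a : ℕ, (((placeOf (pilotDataOfK T.D T.K) pp.1 w).asIdeal.ramificationIdx ℤ : ℕ) : ℤ) ≠
              ((pp : ℕ) : ℤ) ^ a * (((pp : ℕ) : ℤ) - 1)) ∨
            2 ≤ (placeOf (pilotDataOfK T.D T.K) pp.1 w).asIdeal.inertiaDeg ℤ)
    (hL : LedgerAtDatum T) :
    T.Cor312NonarchOf :=
  cor312NonarchOf_of_ledgerAtDatum_outer_of_isGalois M archPk archSub Ψ act Mmod region n lat sig split qData T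
    (isGalois_rat_K_of_jInv_mem_range T hj) hO hL

include M archPk archSub Ψ act Mmod region n lat sig split qData in
/-- **`K2Target27` on the RATIONAL-`j` stratum, TIES INCLUDED** — from ONE structural hypothesis on the POINT and the two ramification columns:
every Σ₂₇ datum (antecedents of `K2Target27` VERBATIM) has `j(λ) ∈ ℚ` and, at each bad place `w ∣ p`, `e(𝔭_w∣p) ≠ p^a(p−1)` for all `a` OR
`f(𝔭_w∣p) ≥ 2`. Explicit 1; NO witness data, NO Galois hypothesis (abc-iut-rh2-L1's `k2Target27_of_isGalois_outer` with Galois-ness from `j(λ) ∈ ℚ`).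
[cite: NeukirchANT1999, Ch. I §9 (9.1), Ch. II (5.5)–(5.7)] [claim: Mochizuki2012, status: disputed] -/
theorem k2Target27_of_jInv_mem_range_outer
    (hJO : ∀ (P : NFPoint), P ∈ UP → ∀ (l : ℕ), l.Prime → 5 ≤ l →
      Cor22.AdmitsCore P → Cor22.CondP2 P l → Cor22.CondP5 P l → Cor22.CondP6 P l →
      (((l : ℝ) + 5) / 4 < (Cor22.dmod P : ℝ) ∨
        6 * l * (((l : ℝ) + 5) - 4 * Cor22.dmod P) / (((l : ℝ) + 4) * ((l : ℝ) - 3))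
            * (P.logDiff + (1 - 1 / (l : ℝ)) * Cor22.logCondAvoid P {2, l})
          + 6 * l * ((l : ℝ) + 5) / (((l : ℝ) + 4) * ((l : ℝ) - 3)) * Real.log Real.pi < Cor22.logQAvoid P {2, l}) →
      ∀ (T : Cor22.ThetaVolumeDatumAt P l), letI := T.instFieldF; letI := T.instNumberFieldF; letI := T.instAlgebraF; letI := T.instFieldK;
        letI := T.instNumberFieldK; letI := T.instAlgebraK; letI := T.instFieldFbar; letI := T.instAlgebraFbar;
        letI := T.instAlgebraKFbar; letI := T.instIsElliptic;
      ¬ (∃ (pp : Nat.Primes) (_ : 2 < (pp : ℕ)) (i : Fin (thetaIndex (pilotDataOfK T.D T.K)).lstar)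
          (x₀ : (thetaIndex (pilotDataOfK T.D T.K)).Fibre (.inr pp)),
        haveI : Fact (pp : ℕ).Prime := ⟨pp.2⟩
        ((pp : ℕ) : ℝ) ^ ((((i : ℕ) : ℝ) + 2) * (4 + 2 * Real.logb (pp : ℕ) (Module.finrank ℚ T.K)) + 1) *
          ‖(exists_realising_qIdeles_pilotDataOfK T.D).choose pp x₀‖ ^ (((i : ℕ) + 1) ^ 2 - 1) < 1) →
      Cor22.jInv P.x ∈ Set.range (algebraMap ℚ P.F) ∧
        (∀ (pp : Nat.Primes) (w : (thetaIndex (pilotDataOfK T.D T.K)).Fibre (.inr pp)), haveI : Fact (pp : ℕ).Prime := ⟨pp.2⟩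
        placeOf (pilotDataOfK T.D T.K) pp.1 w ∈ (pilotDataOfK T.D T.K).S →
          (∀ a : ℕ, (((placeOf (pilotDataOfK T.D T.K) pp.1 w).asIdeal.ramificationIdx ℤ : ℕ) : ℤ) ≠
              ((pp : ℕ) : ℤ) ^ a * (((pp : ℕ) : ℤ) - 1)) ∨
            2 ≤ (placeOf (pilotDataOfK T.D T.K) pp.1 w).asIdeal.inertiaDeg ℤ)) :
    K2Target27 := by
  intro P hP l hl h5 hc h2 h5' h6 hbad T hwin hL
  obtain ⟨hj, hO⟩ := hJO P hP l hl h5 hc h2 h5' h6 hbad T hwin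
  exact cor312NonarchOf_of_ledgerAtDatum_outer_of_jInv_mem_range M archPk archSub Ψ act Mmod region n lat sig split qData T hj hO hL

include M archPk archSub Ψ act Mmod region n lat sig split qData in
/-- **`K2Target27` on the RATIONAL-`λ` stratum (the Frey–Hellegouarch presentation), TIES INCLUDED** — every Σ₂₇ datum has `λ ∈ ℚ` and (O) at
its bad places ⟹ `K2Target27`; a λ-term over `k2Target27_of_jInv_mem_range_outer` via §1 (`λ ∈ ℚ ⟹ j(λ) ∈ ℚ`). Explicit 1, no witness data.
[cite: MochizukiGenEll2010, §1 p.4] [cite: NeukirchANT1999, Ch. II (5.5)–(5.7)] [claim: Mochizuki2012, status: disputed] -/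
theorem k2Target27_of_x_mem_range_outer
    (hXO : ∀ (P : NFPoint), P ∈ UP → ∀ (l : ℕ), l.Prime → 5 ≤ l →
      Cor22.AdmitsCore P → Cor22.CondP2 P l → Cor22.CondP5 P l → Cor22.CondP6 P l →
      (((l : ℝ) + 5) / 4 < (Cor22.dmod P : ℝ) ∨
        6 * l * (((l : ℝ) + 5) - 4 * Cor22.dmod P) / (((l : ℝ) + 4) * ((l : ℝ) - 3))
            * (P.logDiff + (1 - 1 / (l : ℝ)) * Cor22.logCondAvoid P {2, l})
          + 6 * l * ((l : ℝ) + 5) / (((l : ℝ) + 4) * ((l : ℝ) - 3)) * Real.log Real.pi < Cor22.logQAvoid P {2, l}) →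
      ∀ (T : Cor22.ThetaVolumeDatumAt P l), letI := T.instFieldF; letI := T.instNumberFieldF; letI := T.instAlgebraF; letI := T.instFieldK;
        letI := T.instNumberFieldK; letI := T.instAlgebraK; letI := T.instFieldFbar; letI := T.instAlgebraFbar;
        letI := T.instAlgebraKFbar; letI := T.instIsElliptic;
      ¬ (∃ (pp : Nat.Primes) (_ : 2 < (pp : ℕ)) (i : Fin (thetaIndex (pilotDataOfK T.D T.K)).lstar)
          (x₀ : (thetaIndex (pilotDataOfK T.D T.K)).Fibre (.inr pp)),
        haveI : Fact (pp : ℕ).Prime := ⟨pp.2⟩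
        ((pp : ℕ) : ℝ) ^ ((((i : ℕ) : ℝ) + 2) * (4 + 2 * Real.logb (pp : ℕ) (Module.finrank ℚ T.K)) + 1) *
          ‖(exists_realising_qIdeles_pilotDataOfK T.D).choose pp x₀‖ ^ (((i : ℕ) + 1) ^ 2 - 1) < 1) →
      P.x ∈ Set.range (algebraMap ℚ P.F) ∧
        (∀ (pp : Nat.Primes) (w : (thetaIndex (pilotDataOfK T.D T.K)).Fibre (.inr pp)), haveI : Fact (pp : ℕ).Prime := ⟨pp.2⟩
        placeOf (pilotDataOfK T.D T.K) pp.1 w ∈ (pilotDataOfK T.D T.K).S →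
          (∀ a : ℕ, (((placeOf (pilotDataOfK T.D T.K) pp.1 w).asIdeal.ramificationIdx ℤ : ℕ) : ℤ) ≠
              ((pp : ℕ) : ℤ) ^ a * (((pp : ℕ) : ℤ) - 1)) ∨
            2 ≤ (placeOf (pilotDataOfK T.D T.K) pp.1 w).asIdeal.inertiaDeg ℤ)) :
    K2Target27 := by
  refine k2Target27_of_jInv_mem_range_outer M archPk archSub Ψ act Mmod region n lat sig split qData
    (fun P hP l hl h5 hc h2 h5' h6 hbad T hwin => ?_)
  obtain ⟨hx, hO⟩ := hXO P hP l hl h5 hc h2 h5' h6 hbad T hwin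
  exact ⟨jInv_mem_range_of_mem_range hx, hO⟩

/-! ## §3. The R14 recut of the tie-covering certificate-free roads to abc (`hregBad`, abc-iut-s2-p2's binder VERBATIM) -/

include M archPk archSub Ψ act Mmod region n lat sig split qData in
/-- **EXPLICIT-4, certificate-free, ties included, recut: `HStar27OnSigma27 ∧ (K/ℚ Galois ∧ (O))|Σ₂₇ ∧ NUM(deep ∧ bad) ∧ CONE-bad ⟹ ABC`** —
abc-iut-rh2-L1's `k2Target27_of_isGalois_outer` (its hypothesis `hGO` VERBATIM) ∘ p480035's `abc_of_k2Target27_of_hStar27OnSigma27_hregBad` (cone binder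
cut to the SZPIRO-BAD locus). Explicit 4 = H⋆₂₇(Σ₂₇) · GAL∧(O)(Σ₂₇) · NUM(deep ∧ bad) · CONE(Szpiro-bad); H⋆₂₇ is a HYPOTHESIS, `hregBad` an
assumption label; nothing asserted; no side taken on [IUTchIII] Cor. 3.12. [cite: Mochizuki2012, IUTchIII Cor. 3.12 p. 173–174; IUTchIV Cor. 2.2 (ii)
p. 46] [cite: NeukirchANT1999, Ch. I §9 (9.1), Ch. II (5.5)–(5.7)] [claim: Mochizuki2012, status: disputed] -/
theorem abc_of_hStar27OnSigma27_of_isGalois_outer_hregBad (hS : HStar27OnSigma27)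
    (hGO : ∀ (P : NFPoint), P ∈ UP → ∀ (l : ℕ), l.Prime → 5 ≤ l →
      Cor22.AdmitsCore P → Cor22.CondP2 P l → Cor22.CondP5 P l → Cor22.CondP6 P l →
      (((l : ℝ) + 5) / 4 < (Cor22.dmod P : ℝ) ∨
        6 * l * (((l : ℝ) + 5) - 4 * Cor22.dmod P) / (((l : ℝ) + 4) * ((l : ℝ) - 3))
            * (P.logDiff + (1 - 1 / (l : ℝ)) * Cor22.logCondAvoid P {2, l})
          + 6 * l * ((l : ℝ) + 5) / (((l : ℝ) + 4) * ((l : ℝ) - 3)) * Real.log Real.pi < Cor22.logQAvoid P {2, l}) →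
      ∀ (T : Cor22.ThetaVolumeDatumAt P l), letI := T.instFieldF; letI := T.instNumberFieldF; letI := T.instAlgebraF; letI := T.instFieldK;
        letI := T.instNumberFieldK; letI := T.instAlgebraK; letI := T.instFieldFbar; letI := T.instAlgebraFbar;
        letI := T.instAlgebraKFbar; letI := T.instIsElliptic;
      ¬ (∃ (pp : Nat.Primes) (_ : 2 < (pp : ℕ)) (i : Fin (thetaIndex (pilotDataOfK T.D T.K)).lstar)
          (x₀ : (thetaIndex (pilotDataOfK T.D T.K)).Fibre (.inr pp)),
        haveI : Fact (pp : ℕ).Prime := ⟨pp.2⟩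
        ((pp : ℕ) : ℝ) ^ ((((i : ℕ) : ℝ) + 2) * (4 + 2 * Real.logb (pp : ℕ) (Module.finrank ℚ T.K)) + 1) *
          ‖(exists_realising_qIdeles_pilotDataOfK T.D).choose pp x₀‖ ^ (((i : ℕ) + 1) ^ 2 - 1) < 1) →
      IsGalois ℚ T.K ∧
        (∀ (pp : Nat.Primes) (w : (thetaIndex (pilotDataOfK T.D T.K)).Fibre (.inr pp)), haveI : Fact (pp : ℕ).Prime := ⟨pp.2⟩
        placeOf (pilotDataOfK T.D T.K) pp.1 w ∈ (pilotDataOfK T.D T.K).S →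
          (∀ a : ℕ, (((placeOf (pilotDataOfK T.D T.K) pp.1 w).asIdeal.ramificationIdx ℤ : ℕ) : ℤ) ≠
              ((pp : ℕ) : ℤ) ^ a * (((pp : ℕ) : ℤ) - 1)) ∨
            2 ≤ (placeOf (pilotDataOfK T.D T.K) pp.1 w).asIdeal.inertiaDeg ℤ))
    (hNumBad : ∀ (P : NFPoint), P ∈ UP → ∀ (l : ℕ), l.Prime → 5 ≤ l →
      Cor22.AdmitsCore P → Cor22.CondP2 P l → Cor22.CondP5 P l → Cor22.CondP6 P l →
      -- ONLY at SZPIRO-BAD `(P, l)`: elsewhere `T.Cor312Of` is the theorem `Cor22.ThetaVolumeDatumAt.cor312Of_of_szpiro` (abc-iut-c312-d1)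
      (((l : ℝ) + 5) / 4 < (Cor22.dmod P : ℝ) ∨
        6 * l * (((l : ℝ) + 5) - 4 * Cor22.dmod P) / (((l : ℝ) + 4) * ((l : ℝ) - 3))
            * (P.logDiff + (1 - 1 / (l : ℝ)) * Cor22.logCondAvoid P {2, l})
          + 6 * l * ((l : ℝ) + 5) / (((l : ℝ) + 4) * ((l : ℝ) - 3)) * Real.log Real.pi < Cor22.logQAvoid P {2, l}) →
      ∀ (T : Cor22.ThetaVolumeDatumAt P l), letI := T.instFieldF; letI := T.instNumberFieldF; letI := T.instAlgebraF; letI := T.instFieldK;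
        letI := T.instNumberFieldK; letI := T.instAlgebraK; letI := T.instFieldFbar; letI := T.instAlgebraFbar;
        letI := T.instAlgebraKFbar; letI := T.instIsElliptic;
      (∃ (pp : Nat.Primes) (_ : 2 < (pp : ℕ)) (i : Fin (thetaIndex (pilotDataOfK T.D T.K)).lstar)
          (x₀ : (thetaIndex (pilotDataOfK T.D T.K)).Fibre (.inr pp)),
        haveI : Fact (pp : ℕ).Prime := ⟨pp.2⟩
        ((pp : ℕ) : ℝ) ^ ((((i : ℕ) : ℝ) + 2) * (4 + 2 * Real.logb (pp : ℕ) (Module.finrank ℚ T.K)) + 1) *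
          ‖(exists_realising_qIdeles_pilotDataOfK T.D).choose pp x₀‖ ^ (((i : ℕ) + 1) ^ 2 - 1) < 1) → T.Cor312Of)
    -- [CONE, Szpiro-bad] the off-regime hull estimate with print's constant `B_III(P,l)`, demanded ONLY at SZPIRO-BAD admissible `(P, l)`
    (hregBad : ∀ P : NFPoint, P ∈ UP → ∀ l : ℕ, l.Prime → 5 ≤ l →
      Cor22.AdmitsCore P → Cor22.CondP2 P l → Cor22.CondP5 P l → Cor22.CondP6 P l →
      (((l : ℝ) + 5) / 4 < (Cor22.dmod P : ℝ) ∨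
        6 * l * (((l : ℝ) + 5) - 4 * Cor22.dmod P) / (((l : ℝ) + 4) * ((l : ℝ) - 3))
            * (P.logDiff + (1 - 1 / (l : ℝ)) * Cor22.logCondAvoid P {2, l})
          + 6 * l * ((l : ℝ) + 5) / (((l : ℝ) + 4) * ((l : ℝ) - 3)) * Real.log Real.pi < Cor22.logQAvoid P {2, l}) →
      ∀ T : Cor22.ThetaVolumeDatumAt P l,
        (letI := T.instFieldF; letI := T.instNumberFieldF; letI := T.instAlgebraF; letI := T.instFieldK
         letI := T.instNumberFieldK; letI := T.instAlgebraK; letI := T.instFieldFbar; letI := T.instAlgebraFbar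
         letI := T.instAlgebraKFbar; letI := T.instIsElliptic
         ¬ (∀ p ∈ T.I.supportPrimes, ∀ v w : placesOver (fieldOfModuli T.E) p,
            (Summit.ABC.IUTFork.DHData.ofInput T.I).logQloc p v = (Summit.ABC.IUTFork.DHData.ofInput T.I).logQloc p w)) →
        T.HullEstimateOf
          (((l : ℝ) + 1) / 4 *
            ((1 + 12 * (Cor22.dmod P : ℝ) / l) * (P.logDiff + Cor22.logCondAvoid P {2, l})
              + 2 * Real.log l + 52
              + 20 / 3 * Real.log (((2 ^ 12 * 3 ^ 3 * 5 * Cor22.dmod P : ℕ) : ℝ) * (l : ℝ))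
                * (Nat.primeCounting (2 ^ 12 * 3 ^ 3 * 5 * Cor22.dmod P * l) : ℝ))))
    : _root_.ABC :=
  abc_of_k2Target27_of_hStar27OnSigma27_hregBad
    (k2Target27_of_isGalois_outer M archPk archSub Ψ act Mmod region n lat sig split qData hGO) hS hNumBad hregBad

include M archPk archSub Ψ act Mmod region n lat sig split qData in
/-- **EXPLICIT-4, certificate-free, ties included, recut, RATIONAL-`j` bed: `HStar27OnSigma27 ∧ (j(λ) ∈ ℚ ∧ (O))|Σ₂₇ ∧ NUM(deep ∧ bad) ∧ CONE-bad
⟹ ABC`** — §2's `k2Target27_of_jInv_mem_range_outer` ∘ p480035's `abc_of_k2Target27_of_hStar27OnSigma27_hregBad`. Explicit 4 = H⋆₂₇(Σ₂₇) ·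
(j ∈ ℚ ∧ (O))(Σ₂₇) · NUM(deep ∧ bad) · CONE(Szpiro-bad) — the structural class is a condition on the point and the columns `(e_w, f_w)` only. H⋆₂₇ is a
HYPOTHESIS, `hregBad` an assumption label; nothing asserted; no side taken on [IUTchIII] Cor. 3.12. [cite: Mochizuki2012, IUTchI Rmk. 3.1.5 p. 65;
IUTchIII Cor. 3.12 p. 173–174; IUTchIV Cor. 2.2 (ii) p. 46] [cite: NeukirchANT1999, Ch. I §9 (9.1), Ch. II (5.5)–(5.7)] [claim: Mochizuki2012, status: disputed] -/
theorem abc_of_hStar27OnSigma27_of_jInv_mem_range_outer_hregBad (hS : HStar27OnSigma27)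
    (hJO : ∀ (P : NFPoint), P ∈ UP → ∀ (l : ℕ), l.Prime → 5 ≤ l →
      Cor22.AdmitsCore P → Cor22.CondP2 P l → Cor22.CondP5 P l → Cor22.CondP6 P l →
      (((l : ℝ) + 5) / 4 < (Cor22.dmod P : ℝ) ∨
        6 * l * (((l : ℝ) + 5) - 4 * Cor22.dmod P) / (((l : ℝ) + 4) * ((l : ℝ) - 3))
            * (P.logDiff + (1 - 1 / (l : ℝ)) * Cor22.logCondAvoid P {2, l})
          + 6 * l * ((l : ℝ) + 5) / (((l : ℝ) + 4) * ((l : ℝ) - 3)) * Real.log Real.pi < Cor22.logQAvoid P {2, l}) →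
      ∀ (T : Cor22.ThetaVolumeDatumAt P l), letI := T.instFieldF; letI := T.instNumberFieldF; letI := T.instAlgebraF; letI := T.instFieldK;
        letI := T.instNumberFieldK; letI := T.instAlgebraK; letI := T.instFieldFbar; letI := T.instAlgebraFbar;
        letI := T.instAlgebraKFbar; letI := T.instIsElliptic;
      ¬ (∃ (pp : Nat.Primes) (_ : 2 < (pp : ℕ)) (i : Fin (thetaIndex (pilotDataOfK T.D T.K)).lstar)
          (x₀ : (thetaIndex (pilotDataOfK T.D T.K)).Fibre (.inr pp)),
        haveI : Fact (pp : ℕ).Prime := ⟨pp.2⟩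
        ((pp : ℕ) : ℝ) ^ ((((i : ℕ) : ℝ) + 2) * (4 + 2 * Real.logb (pp : ℕ) (Module.finrank ℚ T.K)) + 1) *
          ‖(exists_realising_qIdeles_pilotDataOfK T.D).choose pp x₀‖ ^ (((i : ℕ) + 1) ^ 2 - 1) < 1) →
      Cor22.jInv P.x ∈ Set.range (algebraMap ℚ P.F) ∧
        (∀ (pp : Nat.Primes) (w : (thetaIndex (pilotDataOfK T.D T.K)).Fibre (.inr pp)), haveI : Fact (pp : ℕ).Prime := ⟨pp.2⟩
        placeOf (pilotDataOfK T.D T.K) pp.1 w ∈ (pilotDataOfK T.D T.K).S →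
          (∀ a : ℕ, (((placeOf (pilotDataOfK T.D T.K) pp.1 w).asIdeal.ramificationIdx ℤ : ℕ) : ℤ) ≠
              ((pp : ℕ) : ℤ) ^ a * (((pp : ℕ) : ℤ) - 1)) ∨
            2 ≤ (placeOf (pilotDataOfK T.D T.K) pp.1 w).asIdeal.inertiaDeg ℤ))
    (hNumBad : ∀ (P : NFPoint), P ∈ UP → ∀ (l : ℕ), l.Prime → 5 ≤ l →
      Cor22.AdmitsCore P → Cor22.CondP2 P l → Cor22.CondP5 P l → Cor22.CondP6 P l →
      -- ONLY at SZPIRO-BAD `(P, l)`: elsewhere `T.Cor312Of` is the theorem `Cor22.ThetaVolumeDatumAt.cor312Of_of_szpiro` (abc-iut-c312-d1)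
      (((l : ℝ) + 5) / 4 < (Cor22.dmod P : ℝ) ∨
        6 * l * (((l : ℝ) + 5) - 4 * Cor22.dmod P) / (((l : ℝ) + 4) * ((l : ℝ) - 3))
            * (P.logDiff + (1 - 1 / (l : ℝ)) * Cor22.logCondAvoid P {2, l})
          + 6 * l * ((l : ℝ) + 5) / (((l : ℝ) + 4) * ((l : ℝ) - 3)) * Real.log Real.pi < Cor22.logQAvoid P {2, l}) →
      ∀ (T : Cor22.ThetaVolumeDatumAt P l), letI := T.instFieldF; letI := T.instNumberFieldF; letI := T.instAlgebraF; letI := T.instFieldK;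
        letI := T.instNumberFieldK; letI := T.instAlgebraK; letI := T.instFieldFbar; letI := T.instAlgebraFbar;
        letI := T.instAlgebraKFbar; letI := T.instIsElliptic;
      (∃ (pp : Nat.Primes) (_ : 2 < (pp : ℕ)) (i : Fin (thetaIndex (pilotDataOfK T.D T.K)).lstar)
          (x₀ : (thetaIndex (pilotDataOfK T.D T.K)).Fibre (.inr pp)),
        haveI : Fact (pp : ℕ).Prime := ⟨pp.2⟩
        ((pp : ℕ) : ℝ) ^ ((((i : ℕ) : ℝ) + 2) * (4 + 2 * Real.logb (pp : ℕ) (Module.finrank ℚ T.K)) + 1) *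
          ‖(exists_realising_qIdeles_pilotDataOfK T.D).choose pp x₀‖ ^ (((i : ℕ) + 1) ^ 2 - 1) < 1) → T.Cor312Of)
    -- [CONE, Szpiro-bad] the off-regime hull estimate with print's constant `B_III(P,l)`, demanded ONLY at SZPIRO-BAD admissible `(P, l)`
    (hregBad : ∀ P : NFPoint, P ∈ UP → ∀ l : ℕ, l.Prime → 5 ≤ l →
      Cor22.AdmitsCore P → Cor22.CondP2 P l → Cor22.CondP5 P l → Cor22.CondP6 P l →
      (((l : ℝ) + 5) / 4 < (Cor22.dmod P : ℝ) ∨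
        6 * l * (((l : ℝ) + 5) - 4 * Cor22.dmod P) / (((l : ℝ) + 4) * ((l : ℝ) - 3))
            * (P.logDiff + (1 - 1 / (l : ℝ)) * Cor22.logCondAvoid P {2, l})
          + 6 * l * ((l : ℝ) + 5) / (((l : ℝ) + 4) * ((l : ℝ) - 3)) * Real.log Real.pi < Cor22.logQAvoid P {2, l}) →
      ∀ T : Cor22.ThetaVolumeDatumAt P l,
        (letI := T.instFieldF; letI := T.instNumberFieldF; letI := T.instAlgebraF; letI := T.instFieldK
         letI := T.instNumberFieldK; letI := T.instAlgebraK; letI := T.instFieldFbar; letI := T.instAlgebraFbar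
         letI := T.instAlgebraKFbar; letI := T.instIsElliptic
         ¬ (∀ p ∈ T.I.supportPrimes, ∀ v w : placesOver (fieldOfModuli T.E) p,
            (Summit.ABC.IUTFork.DHData.ofInput T.I).logQloc p v = (Summit.ABC.IUTFork.DHData.ofInput T.I).logQloc p w)) →
        T.HullEstimateOf
          (((l : ℝ) + 1) / 4 *
            ((1 + 12 * (Cor22.dmod P : ℝ) / l) * (P.logDiff + Cor22.logCondAvoid P {2, l})
              + 2 * Real.log l + 52
              + 20 / 3 * Real.log (((2 ^ 12 * 3 ^ 3 * 5 * Cor22.dmod P : ℕ) : ℝ) * (l : ℝ))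
                * (Nat.primeCounting (2 ^ 12 * 3 ^ 3 * 5 * Cor22.dmod P * l) : ℝ))))
    : _root_.ABC :=
  abc_of_k2Target27_of_hStar27OnSigma27_hregBad
    (k2Target27_of_jInv_mem_range_outer M archPk archSub Ψ act Mmod region n lat sig split qData hJO) hS hNumBad hregBad

end KFamily

end Summit.ABC.IUTFork.Repair.RH.ReachLedgerQ2

end
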